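import Mathlib.NumberTheory.ModularForms.Discriminant
import Mathlib.NumberTheory.ModularForms.EisensteinSeries.QExpansion
import Mathlib.Analysis.SpecialFunctions.Complex.LogBounds
import Mathlib.Analysis.SpecialFunctions.Log.Summable
import Mathlib.NumberTheory.Bernoulli
import HarnessLib

/-!
# Klein's invariant near the cusp: `j(τ) = 1/q + 744 + O(q)` with an explicit constant

Topic `NumberTheory/EllipticCurves` (level-one modular forms); everything in this file is
**proved**.  It serves the singular-moduli leaf `Literature.NumberTheory.EllipticCurves.singularModuli_classNumberOne` (Cox,
*Primes of the form x² + ny²*, §12.C, table (12.20); `ComplexMultiplicationSingularModuli.lean`,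
`…Rows.lean`, `…Integral.lean`): Cox computes the rows of that table from the integrality of
`j(𝓞_K)` and numerical estimates on `q`-expansions at the CM points ((12.21)–(12.23), there for
Weber's `γ₂ = ∛j`); here is the `q`-expansion estimate for `j` itself.

With `q = e^{2πiτ}` (`Literature.ModularForms.Function.Periodic.qParam 1 (τ : ℂ)`, `= Function.Periodic.qParam 1 τ`), Mathlib's
normalised Eisenstein series `E₄ = 1 + 240 Σ σ₃(n)qⁿ` (`EisensteinSeries.q_expansion_bernoulli`,
`B₄ = −1/30`) and modular discriminant `Δ = η²⁴ = q ∏ (1 − qⁿ)²⁴`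
(`ModularForm.discriminant_eq_q_prod`), for `‖q‖ ≤ 10⁻⁴`:

* `Literature.NumberTheory.EllipticCurves.ModularForms.norm_E₄_sub_sub_le` : `‖E₄(τ) − 1 − 240q‖ ≤ 61560‖q‖²`
  (`σ₃(n) ≤ n⁴ ≤ 16ⁿ`, geometric tail);
* `Literature.NumberTheory.EllipticCurves.ModularForms.norm_E₄_cube_sub_sub_le` : `‖E₄(τ)³ − 1 − 720q‖ ≤ 3.7·10⁵‖q‖²`;
* `Literature.NumberTheory.EllipticCurves.ModularForms.norm_tsum_log_one_sub_pow_add_le` : `‖Σ_{n≥1} log(1 − qⁿ) + q‖ ≤ 2‖q‖²`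
  (`‖log(1 + z) − z‖ ≤ ‖z‖²/(2(1 − ‖z‖))`, Mathlib `Complex.norm_log_one_add_sub_self_le`), and
  `∏(1 − qⁿ) = exp Σ log(1 − qⁿ)` (`Complex.cexp_tsum_eq_tprod`);
* `Literature.NumberTheory.EllipticCurves.ModularForms.norm_inv_tprod_sub_sub_le` : `‖(∏(1 − qⁿ)²⁴)⁻¹ − 1 − 24q‖ ≤ 625‖q‖²`
  (`‖eˣ − 1 − x‖ ≤ ‖x‖²`, Mathlib `Complex.norm_exp_sub_one_sub_id_le`);
* `Literature.NumberTheory.EllipticCurves.ModularForms.norm_E₄_cube_div_discriminant_sub_sub_le` : **`‖E₄³/Δ − 1/q − 744‖ ≤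
  4·10⁵‖q‖`** — the classical `j = q⁻¹ + 744 + 196884q + …` (Serre, *A Course in Arithmetic*,
  VII §3.3 Remark; Cox §11.A, `j(τ) = 1/q + 744 + 196884q + ⋯`) to first order with a crude
  but explicit error constant, which is all the class-number-one computation needs.

`E₄³/Δ` is the `j`-invariant of the lattice `ℤτ + ℤ` (`PeriodPair.j_ofUpperHalfPlane`,
`LatticeJInvariant.lean`).  Mathlib (v4.32.0) has the `q`-expansion coefficients of `E_k` and the
product formula for `Δ`, but no named `j`-function and no such estimate (`lean search` for
`196884`, `744` finds only docstrings).

## References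

* D. A. Cox, *Primes of the form x² + ny²*, 2nd ed., Wiley 2013, §11.A (the `q`-expansion of
  `j`, PDF p. 230), §12.C (12.21)–(12.23) (PDF pp. 266–268).
* J.-P. Serre, *A Course in Arithmetic*, GTM 7, Springer 1973, VII §3.3 and §4.4.
-/

noncomputable section

open Complex Filter Topology ArithmeticFunction
open UpperHalfPlane hiding I
open scoped Real

namespace Literature.NumberTheory.EllipticCurves.ModularForms

/-- Mathlib's `q`-parameter `qParam 1 τ = e^{2πiτ}` is the nome `q` of `τ ∈ ℍ`. [folklore] -/
lemma qParam_one_eq_cexp (τ : ℍ) : Function.Periodic.qParam 1 (τ : ℂ) = cexp (2 * π * Complex.I * τ) := by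
  simp [Function.Periodic.qParam]

/-- `‖q‖ < 1` on the upper half plane. [folklore] -/
lemma norm_qParam_one_lt_one (τ : ℍ) : ‖Function.Periodic.qParam 1 (τ : ℂ)‖ < 1 := by
  rw [qParam_one_eq_cexp]; exact norm_exp_two_pi_I_lt_one τ

/-! ### The `q`-expansion of `E₄` near the cusp -/

/-- `E₄(τ) = 1 + 240 Σ_{n ≥ 1} σ₃(n) qⁿ`. [folklore] -/
theorem E₄_eq_tsum (τ : ℍ) :
    ModularForm.E₄ τ = 1 + 240 * ∑' n : ℕ, (sigma 3 (n + 1) : ℂ) * Function.Periodic.qParam 1 (τ : ℂ) ^ (n + 1) := by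
  rw [qParam_one_eq_cexp]
  have h := EisensteinSeries.q_expansion_bernoulli (k := 4) (by norm_num) (by decide) τ
  have hb : (bernoulli 4 : ℚ) = -1 / 30 := by
    rw [bernoulli_eq_bernoulli'_of_ne_one (by norm_num), bernoulli'_four]
  have hcoef : (2 * (4 : ℕ) / (bernoulli 4 : ℚ) : ℂ) = -240 := by
    rw [hb]; push_cast; norm_num
  rw [show ModularForm.E₄ τ = ModularForm.E (by norm_num : 3 ≤ 4) τ from rfl, h]
  simp only [Nat.cast_ofNat] at hcoef ⊢
  rw [show (2 * 4 / ((bernoulli 4 : ℚ) : ℂ)) = -240 by exact_mod_cast hcoef]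
  rw [← tsum_pnat_eq_tsum_succ (f := fun n : ℕ ↦ (sigma 3 n : ℂ) * cexp (2 * π * Complex.I * τ) ^ n)]
  rw [neg_mul, sub_neg_eq_add]
  congr 2

/-- Summability of the `q`-series `Σ σ₃(n) qⁿ`. [folklore] -/
lemma summable_sigma_mul_qParam_pow (τ : ℍ) :
    Summable fun n : ℕ ↦ (sigma 3 n : ℂ) * Function.Periodic.qParam 1 (τ : ℂ) ^ n := by
  simpa [qParam_one_eq_cexp] using
    EisensteinSeries.summable_sigma_mul_cexp_pow (k := 4) (by norm_num) τ

/-- `σ₃(n) ≤ n⁴ ≤ 16ⁿ`. [folklore] -/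
lemma sigma_three_le_sixteen_pow (n : ℕ) : (sigma 3 n : ℝ) ≤ 16 ^ n := by
  have h1 : sigma 3 n ≤ n ^ 4 := sigma_le_pow_succ 3 n
  have h2 : n ^ 4 ≤ 16 ^ n := by
    calc n ^ 4 ≤ (2 ^ n) ^ 4 := Nat.pow_le_pow_left Nat.lt_two_pow_self.le 4
      _ = 16 ^ n := by rw [← pow_mul, mul_comm, pow_mul]; norm_num
  exact_mod_cast h1.trans h2

/-- **`E₄` near the cusp**: for `‖q‖ ≤ 10⁻⁴`, `‖E₄(τ) − 1 − 240q‖ ≤ 61560‖q‖²`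
(the tail `240 Σ_{n ≥ 2} σ₃(n)qⁿ`, with `σ₃(n) ≤ 16ⁿ`). [folklore] -/
theorem norm_E₄_sub_sub_le (τ : ℍ) (hq : ‖Function.Periodic.qParam 1 (τ : ℂ)‖ ≤ 1 / 10 ^ 4) :
    ‖ModularForm.E₄ τ - 1 - 240 * Function.Periodic.qParam 1 (τ : ℂ)‖ ≤ 61560 * ‖Function.Periodic.qParam 1 (τ : ℂ)‖ ^ 2 := by
  set q := Function.Periodic.qParam 1 (τ : ℂ) with hqdef
  set r := ‖q‖ with hr
  have hr0 : 0 ≤ r := norm_nonneg _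
  have hr1 : r ≤ 1 / 10 ^ 4 := hq
  have hs := summable_sigma_mul_qParam_pow τ
  have hs1 : Summable fun n : ℕ ↦ (sigma 3 (n + 1) : ℂ) * q ^ (n + 1) :=
    (summable_nat_add_iff (f := fun n : ℕ ↦ (sigma 3 n : ℂ) * q ^ n) 1).mpr hs
  have hs2 : Summable fun n : ℕ ↦ (sigma 3 (n + 2) : ℂ) * q ^ (n + 2) :=
    (summable_nat_add_iff (f := fun n : ℕ ↦ (sigma 3 n : ℂ) * q ^ n) 2).mpr hs
  -- split off the first term `σ₃(1) q = q`
  have hsplit : ∑' n : ℕ, (sigma 3 (n + 1) : ℂ) * q ^ (n + 1) =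
      q + ∑' n : ℕ, (sigma 3 (n + 2) : ℂ) * q ^ (n + 2) := by
    rw [hs1.tsum_eq_zero_add]
    simp only [zero_add, sigma_one, Nat.cast_one, one_mul, pow_one]
  have hE : ModularForm.E₄ τ - 1 - 240 * q = 240 * ∑' n : ℕ, (sigma 3 (n + 2) : ℂ) * q ^ (n + 2) := by
    rw [E₄_eq_tsum, ← hqdef, hsplit]; ring
  -- the tail is bounded by the geometric series `Σ (16 r)^{n+2}`
  have h16 : 16 * r < 1 := by nlinarith
  have hgeom : HasSum (fun n : ℕ ↦ (16 * r) ^ 2 * (16 * r) ^ n) ((16 * r) ^ 2 * (1 - 16 * r)⁻¹) :=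
    (hasSum_geometric_of_lt_one (by positivity) h16).mul_left _
  have htail : ‖∑' n : ℕ, (sigma 3 (n + 2) : ℂ) * q ^ (n + 2)‖ ≤ (16 * r) ^ 2 * (1 - 16 * r)⁻¹ := by
    refine tsum_of_norm_bounded hgeom fun n ↦ ?_
    rw [norm_mul, norm_pow, Complex.norm_natCast, ← hr,
      show (16 * r) ^ 2 * (16 * r) ^ n = 16 ^ (n + 2) * r ^ (n + 2) by ring]
    exact mul_le_mul_of_nonneg_right (sigma_three_le_sixteen_pow (n + 2)) (pow_nonneg hr0 _)
  rw [hE, norm_mul, show ‖(240 : ℂ)‖ = 240 by norm_num]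
  have hinv : (1 - 16 * r)⁻¹ ≤ 10017 / 10000 := by
    rw [inv_le_comm₀ (by linarith) (by norm_num)]
    nlinarith
  calc 240 * ‖∑' n : ℕ, (sigma 3 (n + 2) : ℂ) * q ^ (n + 2)‖
      ≤ 240 * ((16 * r) ^ 2 * (1 - 16 * r)⁻¹) := by gcongr
    _ ≤ 240 * ((16 * r) ^ 2 * (10017 / 10000)) := by gcongr
    _ ≤ 61560 * r ^ 2 := by nlinarith

/-- **`E₄³` near the cusp**: for `‖q‖ ≤ 10⁻⁴`, `‖E₄(τ)³ − 1 − 720q‖ ≤ 370000‖q‖²`. [folklore] -/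
theorem norm_E₄_cube_sub_sub_le (τ : ℍ) (hq : ‖Function.Periodic.qParam 1 (τ : ℂ)‖ ≤ 1 / 10 ^ 4) :
    ‖ModularForm.E₄ τ ^ 3 - 1 - 720 * Function.Periodic.qParam 1 (τ : ℂ)‖ ≤ 370000 * ‖Function.Periodic.qParam 1 (τ : ℂ)‖ ^ 2 := by
  set q := Function.Periodic.qParam 1 (τ : ℂ) with hqdef
  set r := ‖q‖ with hr
  have hr0 : 0 ≤ r := norm_nonneg _
  have hr1 : r ≤ 1 / 10 ^ 4 := hq
  set ε := ModularForm.E₄ τ - 1 - 240 * q with hεdef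
  set u := ModularForm.E₄ τ - 1 with hudef
  have hε : ‖ε‖ ≤ 61560 * r ^ 2 := norm_E₄_sub_sub_le τ hq
  have hu : ‖u‖ ≤ 2462 / 10 * r := by
    have h1 : u = 240 * q + ε := by simp only [hεdef, hudef]; ring
    calc ‖u‖ = ‖240 * q + ε‖ := by rw [h1]
      _ ≤ ‖(240 : ℂ) * q‖ + ‖ε‖ := norm_add_le _ _
      _ = 240 * r + ‖ε‖ := by rw [norm_mul, hr]; norm_num
      _ ≤ 240 * r + 61560 * r ^ 2 := by linarith
      _ ≤ 2462 / 10 * r := by nlinarith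
  have hid : ModularForm.E₄ τ ^ 3 - 1 - 720 * q = 3 * ε + 3 * u ^ 2 + u ^ 3 := by
    simp only [hεdef, hudef]; ring
  rw [hid]
  have hu0 : 0 ≤ ‖u‖ := norm_nonneg _
  calc ‖3 * ε + 3 * u ^ 2 + u ^ 3‖ ≤ ‖3 * ε‖ + ‖3 * u ^ 2‖ + ‖u ^ 3‖ := norm_add₃_le
    _ = 3 * ‖ε‖ + 3 * ‖u‖ ^ 2 + ‖u‖ ^ 3 := by simp [norm_pow]
    _ ≤ 3 * (61560 * r ^ 2) + 3 * (2462 / 10 * r) ^ 2 + (2462 / 10 * r) ^ 3 := by gcongr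
    _ ≤ 370000 * r ^ 2 := by nlinarith

/-! ### The Euler product `∏ (1 − qⁿ)` near `q = 0` -/

/-- `1 − qⁿ⁺¹ ≠ 0` for `‖q‖ < 1`. [folklore] -/
lemma one_sub_pow_succ_ne_zero {q : ℂ} (hq : ‖q‖ < 1) (n : ℕ) : 1 - q ^ (n + 1) ≠ 0 := by
  intro h
  have h1 : ‖q ^ (n + 1)‖ = 1 := by rw [← sub_eq_zero.mp h]; simp
  rw [norm_pow] at h1
  have : ‖q‖ ^ (n + 1) < 1 := pow_lt_one₀ (norm_nonneg _) hq (Nat.succ_ne_zero n)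
  linarith

/-- Summability of `Σ log(1 − qⁿ⁺¹)` for `‖q‖ < 1`. [folklore] -/
lemma summable_log_one_sub_pow {q : ℂ} (hq : ‖q‖ < 1) :
    Summable fun n : ℕ ↦ Complex.log (1 - q ^ (n + 1)) := by
  have h : Summable fun n : ℕ ↦ -q ^ (n + 1) :=
    ((summable_nat_add_iff (f := fun n : ℕ ↦ q ^ n) 1).mpr
      (summable_geometric_of_norm_lt_one hq)).neg
  simpa [sub_eq_add_neg] using Complex.summable_log_one_add_of_summable h

/-- `∏ (1 − qⁿ⁺¹) = exp (Σ log(1 − qⁿ⁺¹))` for `‖q‖ < 1`. [folklore] -/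
lemma cexp_tsum_log_one_sub_pow {q : ℂ} (hq : ‖q‖ < 1) :
    cexp (∑' n : ℕ, Complex.log (1 - q ^ (n + 1))) = ∏' n : ℕ, (1 - q ^ (n + 1)) :=
  Complex.cexp_tsum_eq_tprod (one_sub_pow_succ_ne_zero hq) (summable_log_one_sub_pow hq)

/-- **First-order expansion of `log ∏ (1 − qⁿ)`**: for `‖q‖ ≤ 10⁻⁴`,
`‖Σ_{n ≥ 1} log(1 − qⁿ) + q‖ ≤ 2‖q‖²`. [folklore] -/
theorem norm_tsum_log_one_sub_pow_add_le {q : ℂ} (hq : ‖q‖ ≤ 1 / 10 ^ 4) :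
    ‖∑' n : ℕ, Complex.log (1 - q ^ (n + 1)) + q‖ ≤ 2 * ‖q‖ ^ 2 := by
  set r := ‖q‖ with hr
  have hr0 : 0 ≤ r := norm_nonneg _
  have hr1 : r ≤ 1 / 10 ^ 4 := hq
  have hq1 : ‖q‖ < 1 := by rw [← hr]; linarith
  -- the pieces
  set a : ℕ → ℂ := fun n ↦ Complex.log (1 - q ^ (n + 1)) + q ^ (n + 1) with ha
  have hg : Summable fun n : ℕ ↦ q ^ n := summable_geometric_of_norm_lt_one hq1
  have hg1 : Summable fun n : ℕ ↦ q ^ (n + 1) := (summable_nat_add_iff (f := fun n ↦ q ^ n) 1).mpr hg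
  have hg2 : Summable fun n : ℕ ↦ q ^ (n + 2) := (summable_nat_add_iff (f := fun n ↦ q ^ n) 2).mpr hg
  have hsa : Summable a := (summable_log_one_sub_pow hq1).add hg1
  have hdecomp : ∑' n : ℕ, Complex.log (1 - q ^ (n + 1)) + q =
      ∑' n, a n - ∑' n : ℕ, q ^ (n + 2) := by
    have h1 : ∑' n : ℕ, Complex.log (1 - q ^ (n + 1)) = ∑' n, a n - ∑' n : ℕ, q ^ (n + 1) := by
      rw [← hsa.tsum_sub hg1]
      exact tsum_congr fun n ↦ by simp [ha]
    have h2 : ∑' n : ℕ, q ^ (n + 1) = q + ∑' n : ℕ, q ^ (n + 2) := by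
      rw [hg1.tsum_eq_zero_add]
      simp only [zero_add, pow_one]
    rw [h1, h2]; ring
  -- bound on `Σ a`
  have hr2 : r ^ 2 < 1 := by nlinarith
  have hc : (1 - r)⁻¹ / 2 ≤ 50006 / 100000 := by
    rw [div_le_iff₀ (by norm_num : (0:ℝ) < 2), inv_le_comm₀ (by linarith) (by norm_num)]
    linarith
  have hgeomA : HasSum (fun n : ℕ ↦ (50006 / 100000 * r ^ 2) * (r ^ 2) ^ n)
      ((50006 / 100000 * r ^ 2) * (1 - r ^ 2)⁻¹) :=
    (hasSum_geometric_of_lt_one (by positivity) hr2).mul_left _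
  have hA : ‖∑' n, a n‖ ≤ (50006 / 100000 * r ^ 2) * (1 - r ^ 2)⁻¹ := by
    refine tsum_of_norm_bounded hgeomA fun n ↦ ?_
    have hqn : ‖-q ^ (n + 1)‖ < 1 := by
      rw [norm_neg, norm_pow]
      exact pow_lt_one₀ hr0 hq1 (Nat.succ_ne_zero n)
    have h1 := Complex.norm_log_one_add_sub_self_le hqn
    have h2 : a n = Complex.log (1 + -q ^ (n + 1)) - -q ^ (n + 1) := by
      simp only [ha, sub_eq_add_neg, neg_neg]
    rw [h2]
    refine h1.trans ?_
    rw [norm_neg, norm_pow, ← hr]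
    have hrn : r ^ (n + 1) ≤ r := by
      calc r ^ (n + 1) ≤ r ^ 1 := pow_le_pow_of_le_one hr0 (by linarith) (by omega)
        _ = r := pow_one r
    have hrn0 : 0 ≤ r ^ (n + 1) := pow_nonneg hr0 _
    have hinv : (1 - r ^ (n + 1))⁻¹ ≤ (1 - r)⁻¹ := by
      gcongr
    calc (r ^ (n + 1)) ^ 2 * (1 - r ^ (n + 1))⁻¹ / 2
        ≤ (r ^ (n + 1)) ^ 2 * (1 - r)⁻¹ / 2 := by gcongr
      _ = ((1 - r)⁻¹ / 2) * (r ^ 2 * (r ^ 2) ^ n) := by ring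
      _ ≤ 50006 / 100000 * (r ^ 2 * (r ^ 2) ^ n) := by gcongr
      _ = 50006 / 100000 * r ^ 2 * (r ^ 2) ^ n := by ring
  -- bound on `Σ q^{n+2}`
  have hgeomB : HasSum (fun n : ℕ ↦ r ^ 2 * r ^ n) (r ^ 2 * (1 - r)⁻¹) :=
    (hasSum_geometric_of_lt_one hr0 hq1).mul_left _
  have hB : ‖∑' n : ℕ, q ^ (n + 2)‖ ≤ r ^ 2 * (1 - r)⁻¹ := by
    refine tsum_of_norm_bounded hgeomB fun n ↦ ?_
    rw [norm_pow, ← hr, pow_add, mul_comm]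
  have hinv1 : (1 - r)⁻¹ ≤ 10002 / 10000 := by
    rw [inv_le_comm₀ (by linarith) (by norm_num)]; linarith
  have hinv2 : (1 - r ^ 2)⁻¹ ≤ 10002 / 10000 := by
    rw [inv_le_comm₀ (by linarith) (by norm_num)]; nlinarith
  rw [hdecomp]
  calc ‖∑' n, a n - ∑' n : ℕ, q ^ (n + 2)‖ ≤ ‖∑' n, a n‖ + ‖∑' n : ℕ, q ^ (n + 2)‖ := norm_sub_le _ _
    _ ≤ (50006 / 100000 * r ^ 2) * (1 - r ^ 2)⁻¹ + r ^ 2 * (1 - r)⁻¹ := add_le_add hA hB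
    _ ≤ (50006 / 100000 * r ^ 2) * (10002 / 10000) + r ^ 2 * (10002 / 10000) := by gcongr
    _ ≤ 2 * r ^ 2 := by nlinarith

/-- **The reciprocal Euler product near `q = 0`**: for `‖q‖ ≤ 10⁻⁴`,
`‖(∏ (1 − qⁿ⁺¹)²⁴)⁻¹ − 1 − 24q‖ ≤ 625‖q‖²`. [folklore] -/
theorem norm_inv_tprod_sub_sub_le {q : ℂ} (hq : ‖q‖ ≤ 1 / 10 ^ 4) :
    ‖(∏' n : ℕ, (1 - q ^ (n + 1)) ^ 24)⁻¹ - 1 - 24 * q‖ ≤ 625 * ‖q‖ ^ 2 := by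
  set r := ‖q‖ with hr
  have hr0 : 0 ≤ r := norm_nonneg _
  have hr1 : r ≤ 1 / 10 ^ 4 := hq
  have hq1 : ‖q‖ < 1 := by rw [← hr]; linarith
  set L := ∑' n : ℕ, Complex.log (1 - q ^ (n + 1)) with hL
  have hprod : ∏' n : ℕ, (1 - q ^ (n + 1)) ^ 24 = cexp (24 * L) := by
    rw [(ModularForm.multipliable_one_sub_pow hq1).tprod_pow, ← cexp_tsum_log_one_sub_pow hq1,
      ← Complex.exp_nat_mul]
    norm_num [hL]
  rw [hprod, ← Complex.exp_neg]
  set δ := -24 * (L + q) with hδ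
  have hLq : ‖L + q‖ ≤ 2 * r ^ 2 := norm_tsum_log_one_sub_pow_add_le hq
  have hδn : ‖δ‖ ≤ 48 * r ^ 2 := by
    rw [hδ, norm_mul, show ‖(-24 : ℂ)‖ = 24 by norm_num]; linarith
  set x := -(24 * L) with hx
  have hxe : x = 24 * q + δ := by simp only [hx, hδ]; ring
  have hxn : ‖x‖ ≤ 240048 / 10000 * r := by
    rw [hxe]
    calc ‖24 * q + δ‖ ≤ ‖(24 : ℂ) * q‖ + ‖δ‖ := norm_add_le _ _
      _ = 24 * r + ‖δ‖ := by rw [norm_mul, hr]; norm_num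
      _ ≤ 24 * r + 48 * r ^ 2 := by linarith
      _ ≤ 240048 / 10000 * r := by nlinarith
  have hx1 : ‖x‖ ≤ 1 := by linarith [hxn]
  have hexp := Complex.norm_exp_sub_one_sub_id_le hx1
  have hid : cexp x - 1 - 24 * q = (cexp x - 1 - x) + δ := by rw [hxe]; ring
  rw [hid]
  calc ‖cexp x - 1 - x + δ‖ ≤ ‖cexp x - 1 - x‖ + ‖δ‖ := norm_add_le _ _
    _ ≤ ‖x‖ ^ 2 + 48 * r ^ 2 := add_le_add hexp hδn
    _ ≤ (240048 / 10000 * r) ^ 2 + 48 * r ^ 2 := by gcongr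
    _ ≤ 625 * r ^ 2 := by nlinarith

/-! ### Klein's `j` near the cusp -/

/-- **Klein's invariant near the cusp: `j = 1/q + 744 + O(q)` with an explicit constant.**  For
`τ ∈ ℍ` with `‖q‖ ≤ 10⁻⁴` (`q = e^{2πiτ}`),
`‖E₄(τ)³/Δ(τ) − 1/q − 744‖ ≤ 4·10⁵ ‖q‖` (the true next term being `196884 q`).  From
`E₄³ = 1 + 720q + O(q²)` and `1/∏(1 − qⁿ)²⁴ = 1 + 24q + O(q²)`. [folklore] -/
theorem norm_E₄_cube_div_discriminant_sub_sub_le (τ : ℍ) (hq : ‖Function.Periodic.qParam 1 (τ : ℂ)‖ ≤ 1 / 10 ^ 4) :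
    ‖ModularForm.E₄ τ ^ 3 / ModularForm.discriminant τ - (Function.Periodic.qParam 1 (τ : ℂ))⁻¹ - 744‖ ≤
      400000 * ‖Function.Periodic.qParam 1 (τ : ℂ)‖ := by
  set q := Function.Periodic.qParam 1 (τ : ℂ) with hqdef
  set r := ‖q‖ with hr
  have hr0 : 0 < r := norm_pos_iff.mpr (Function.Periodic.qParam_ne_zero (τ : ℂ))
  have hr1 : r ≤ 1 / 10 ^ 4 := hq
  have hq0 : q ≠ 0 := Function.Periodic.qParam_ne_zero (τ : ℂ)
  set P := ∏' n : ℕ, (1 - q ^ (n + 1)) ^ 24 with hP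
  set a := ModularForm.E₄ τ ^ 3 with ha
  set ε₂ := a - 1 - 720 * q with hε₂
  set ε₃ := P⁻¹ - 1 - 24 * q with hε₃
  have h₂ : ‖ε₂‖ ≤ 370000 * r ^ 2 := norm_E₄_cube_sub_sub_le τ hq
  have h₃ : ‖ε₃‖ ≤ 625 * r ^ 2 := norm_inv_tprod_sub_sub_le hq
  have hΔ : ModularForm.discriminant τ = q * P := ModularForm.discriminant_eq_q_prod τ
  have hP0 : P ≠ 0 := by
    intro h0
    exact ModularForm.discriminant_ne_zero τ (by rw [hΔ, h0, mul_zero])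
  have hid : a / ModularForm.discriminant τ - q⁻¹ - 744 =
      (17280 * q ^ 2 + ε₂ * P⁻¹ + ε₃ * (1 + 720 * q)) / q := by
    rw [hΔ]
    simp only [hε₂, hε₃]
    field_simp
    ring
  rw [hid, norm_div, ← hr, div_le_iff₀ hr0]
  have hb : ‖P⁻¹‖ ≤ 1 + 24 * r + 625 * r ^ 2 := by
    have : P⁻¹ = 1 + 24 * q + ε₃ := by simp only [hε₃]; ring
    rw [this]
    calc ‖1 + 24 * q + ε₃‖ ≤ ‖(1 : ℂ) + 24 * q‖ + ‖ε₃‖ := norm_add_le _ _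
      _ ≤ ‖(1 : ℂ)‖ + ‖(24 : ℂ) * q‖ + ‖ε₃‖ := by gcongr; exact norm_add_le _ _
      _ = 1 + 24 * r + ‖ε₃‖ := by rw [norm_mul, hr]; norm_num
      _ ≤ 1 + 24 * r + 625 * r ^ 2 := by linarith
  have hc : ‖(1 : ℂ) + 720 * q‖ ≤ 1 + 720 * r := by
    calc ‖(1 : ℂ) + 720 * q‖ ≤ ‖(1 : ℂ)‖ + ‖(720 : ℂ) * q‖ := norm_add_le _ _
      _ = 1 + 720 * r := by rw [norm_mul, hr]; norm_num
  calc ‖17280 * q ^ 2 + ε₂ * P⁻¹ + ε₃ * (1 + 720 * q)‖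
      ≤ ‖(17280 : ℂ) * q ^ 2‖ + ‖ε₂ * P⁻¹‖ + ‖ε₃ * (1 + 720 * q)‖ := norm_add₃_le
    _ = 17280 * r ^ 2 + ‖ε₂‖ * ‖P⁻¹‖ + ‖ε₃‖ * ‖(1 : ℂ) + 720 * q‖ := by
        rw [norm_mul, norm_mul, norm_mul, norm_pow, hr]; norm_num
    _ ≤ 17280 * r ^ 2 + 370000 * r ^ 2 * (1 + 24 * r + 625 * r ^ 2) +
          625 * r ^ 2 * (1 + 720 * r) := by
        gcongr
    _ = (387905 + 9330000 * r + 231250000 * r ^ 2) * r * r := by ring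
    _ ≤ 400000 * r * r := by
        have h1 : 387905 + 9330000 * r + 231250000 * r ^ 2 ≤ 400000 := by nlinarith
        have h2 : 0 ≤ r * r := by positivity
        nlinarith

end Literature.NumberTheory.EllipticCurves.ModularForms

end
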